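import Literature.MathematicalPhysics.QuantumFieldTheory.Balaban1983to89.B7Prop4GeneralLevels
import Literature.MathematicalPhysics.QuantumFieldTheory.Balaban1983to89.B7Prop3GeneralLinearBound
import Summits.QuantumFields.BalabanUV.T4Continuum.Support.ShellMeasureAverageProp3Discharge

/-!
# [B7] Proposition 4 at a general regular background, k-uniform — THE JUNCTION S55 × S56: the three Prop.-3 binders of
# `B7Prop4GeneralLevels.prop4_general_of_prop3` DISCHARGED BY NAME, the identification `U̿₁ʲ = exp Q_j`, and the
# analyticity clause (`ShellMeasureAverageProp4General`)

Audit cell `pub-balaban`, sub-cell `t4`, NE7c ROUND-2 crew seat `b2b-balaban-t4-ne7c-formalise-leaf-10` gen 9; owner table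
`t4/b2b-balaban-t4-ne7c-p1/LEAVES-NE7c-P1.md` row **S56** «[B7] PROPOSITION 4 (127)–(136) AT A GENERAL REGULAR BACKGROUND
— k-UNIFORM», file 3 of the row (file 1 `B7Prop4GeneralInduction` p219540 = the abstract induction (128)–(133); file 2
`B7Prop4GeneralLevels` p220086 = the composites (127), the level regularity, the k-uniform constant and Prop. 4
CONDITIONAL on three displayed Prop.-3 hypotheses `h3rem` (123) ∕ `h3lin` (126) ∕ `h3sub`).  Source: T. Bałaban,
*Averaging operations for lattice gauge theories*, Commun. Math. Phys. **98**, 17–51 (1985) [Balaban1985Averaging],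
Sect. D pp. 36–39 = PDF pp. 20–23 (renders `b2b-balaban-ref1/pages/1985-cmp98-averaging/…-p020…p023-x2.png` READ AS
IMAGES by this seat).  PLACEMENT: a Summits file, because row S55's (123) lives under `Summits/…` (it imports row D4's
Cauchy estimate); this is OUR junction of reproduction files, not a new printed statement.

WHAT ROW S55 SUPPLIES, BY NAME (none restated): (H-rem) + (H-sub) = `ShellMeasureAverageProp3Discharge.h3rem_discharge`
∕ `h3sub_discharge` (leaf-03-g3, p220425: `prop4_general_of_prop3`'s binders VERBATIM with `βmax := 1/(1024(d+1)(d+4)L²)`,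
`c₃ := c₃(d,L)/2`, `C₁ := 131072(d+1)²`, through `ShellMeasureAverageProp3Remainder.prop3_general_remainder_explicit`
p220333 and `B7Prop3GeneralTild.linQcov_add ∕ linQcov_smul` p220065), (H-an) = `B7Prop3GeneralAnalytic.
prop3_general_analyticAt_of_le_c3` (leaf-03-g3, p220040), (H-lin) = `B7Prop3GeneralLinearBound.norm_linQcov_le`
(leaf-05-g6: (126) «|(Q(V₀)A)_c| ≦ |A| + O(1)L²α₀|A|» with leading coefficient EXACTLY `L`, `O(1) = 50(d+1)` per unit of
LOOP regularity), the loop regularity of a background with small plaquette deviation being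
`ShellMeasureAverageProp3Discharge.loopReg_of_pdev` (= b07's `B7Prop2Explicit.norm_Wcx_sub_one_le`, [B7] Prop. 1).

WHAT THIS FILE PROVES (kernel, 0 sorry).
* §1 the constants made explicit: `C1cov d = 131072(d+1)²` («C₁ depends on d», (123)), `O1cov d = 800(d+1)²(d+4)` (the
  `O(1)` of (126) per unit of PLAQUETTE deviation: `50(d+1)·16(d+1)(d+4)`), `C2cov d = 12·C1cov d` («C₂ = e^{O(1)2α₀}8C₁»,
  «C₂ depends on d», with `e^{O(1)2α₀} ≤ 3/2` under print's bracket «O(1)α₀ ≦ 1/6»).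
* §2 **`h3lin_discharge`** — the LAST binder: `‖L(Q(V₀)A)_c‖ ≤ L·(1 + O1cov(d)·L²β)·a` for `G`-valued `V₀` (`G ≤ U1`),
  `pdev V₀ < β ≤ βmax`, `sup‖A‖ ≤ a`.
* §3 **`prop4_general_bounds`** = `prop4_general_of_prop3` with all three binders discharged: for `U₀` as in Prop. 2
  (`G`-valued, `AvgClosed d L G`, `pdev U₀ < α₀L^{−2k}`, `C₀α₀ ≤ 1/3`) plus `4α₀ ≤ c₂′(d,L)` (print p. 37 «2α₀L^{2j}η² <
  α₀ ≦ c₃»: Prop. 3's regime for the level backgrounds, in plaquette currency — it makes `2α₀ ≤ βmax`), `sup‖B‖ ≤ b`,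
  `e^{4·O1cov·α₀}(1 + 8·C1cov·Lᵏb) ≤ 2` ((131)) and «α₁ ≦ ½c₃» LITERALLY as `2Lᵏb ≤ c₃(d,L)`: (130)/(131) at every `j ≤ k`.
* §4 **`dbavgCovIter_eq_expCfg_logCovIter`** — «(1/i) log U̿₁ᵏ … is a composition of the functions (127)»: the iterate
  (90)/(91) `B7Eq92Concrete.dbavgCovIter L U₀ (e^{B}) j` IS `e^{Q_j(U₀, ηB)}` bondwise for `j ≤ k` (`‖V̿₁ − 1‖ ≤ 4/5` from
  `B7Prop3GeneralAnalytic.logDomainCov` at every level, `B7Prop4Flat.expUnit_mlog`); `mlog_dbavgCovIter`.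
* §5 **`prop4_general_analyticAt`** — Prop. 4's «is an analytic function of the variables A_b»: every composite
  `t ↦ Q_j(U₀, ηB(t))` is bondwise analytic (file 1's `prop4_induction_analyticAt` fed with (H-an) at the level
  backgrounds; parametrised form of b07's `prop4_flat_analyticAt`).
* §6 **`prop4_general`** — the printed shape (134)–(135) + (131) = (161) + `U̿₁ᵏ = exp((1/i) log U̿₁ᵏ)` at the last level,
  under print's bracket «e.g., O(1)α₀ ≦ 1/6, 8C₁α₁ ≦ 1/3» (`smallness_of_bracket`), with `C₂ = C2cov d = 12·C1cov d`
  INDEPENDENT OF `k` AND OF `α₀` («The constants C₂, c₄ are independent of k, C₂ depends on d»).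
DIVERGENCES from print (located): strict `<` ↦ `≤`; «α₀, α₁ ≦ c₄» displayed as the separate inequalities above (print's
`c₄(d, L)` = their minimum); (136) (the expansion of `C_k` in homogeneous polynomials) NOT typed; global sup bounds on `ℤᵈ`.
ABSOLUTE-RULE LEDGER: nothing of the manuscript is cited as a fact — every hypothesis is a displayed inequality or b07's
`AvgClosed` structure; Props 1–3 enter through KERNEL theorems by name.  HONEST (cell): with this file «[B7] Prop. 4 at a
general regular background, k-uniform» is KERNEL for B7's own average under displayed smallness — B11's CITED INPUT [4]
Prop. 4; NOT its sectioned ∕ V-uniform use in [Balaban1985Variational] (44) (W-a stays TYPE); NE7c NOT PRINTED, NOT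
PROVED; spine PROVED 0/9; rung (B)+1 on a FINITE T⁴ — NOT infinite volume, NOT mass gap, NOT Clay.  HONEST DEPENDENCY:
continuum YM on T⁴ ⇐ BetaPertH ∧ nine spine estimates (0/9 proved); BetaPertH ⇐ (D1) ∧ (D4) ∧ CAP+tail; G-an2-4 gates
asym, D1 and NE2/3/4.
-/

noncomputable section

open scoped BigOperators
open NormedSpace Finset

namespace Summit.QuantumFields.BalabanUV.T4Continuum.ShellMeasureAverageProp4General

open Literature.MathematicalPhysics.QuantumFieldTheory.Balaban1983to89
open B7Prop1Explicit B7Prop2Explicit B7Prop3Flat B7Eq92Concrete MatrixLog B7Prop3GeneralLinear B7Prop3GeneralAnalytic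
  B7Prop4GeneralInduction B7Prop4GeneralLevels
open B7Prop3GeneralLinearBound (norm_linQcov_le)
open Summit.QuantumFields.BalabanUV.T4Continuum.ShellMeasureAverageProp3Discharge (loopReg_of_pdev h3rem_discharge
  h3sub_discharge)
open Summit.QuantumFields.BalabanUV.T4Continuum.ShellMeasureAverageProp3Remainder (theta_le_of_le_c3)

variable {d : ℕ}

/-! ## §1 The constants of Propositions 3–4 at a general background, explicit -/

/-- print's `C₁` of (123) «|C(V₀, A, c)| ≦ C₁L²|A|²», «C₁ depends on d», as delivered by row S55's Cauchy estimate
(`ShellMeasureAverageProp3Remainder.prop3_general_remainder_explicit`: `8/c₃(d,L)² = 131072(d+1)²·L²`).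
[cite: Balaban1985Averaging, Proposition 3 (123) p.36] -/
def C1cov (d : ℕ) : ℝ := 131072 * ((d : ℝ) + 1) ^ 2

/-- the `O(1)` of (126) «|(Q(V₀)A)_c| ≦ |A| + O(1)L²α₀|A|» per unit of plaquette deviation `α₀`: `50(d+1)` per unit of loop
regularity (`B7Prop3GeneralLinearBound.norm_linQcov_le`) times `16(d+1)(d+4)` (loop regularity per unit of plaquette
deviation, `loopReg_of_pdev`). [cite: Balaban1985Averaging, (126) p.36] -/
def O1cov (d : ℕ) : ℝ := 800 * ((d : ℝ) + 1) ^ 2 * ((d : ℝ) + 4)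

/-- print's `C₂` of (135) «C₂ = e^{O(1)2α₀}8C₁», «C₂ depends on d»: `12·C1cov d`, the factor `e^{O(1)2α₀}` being `≤ 3/2`
under print's bracket «O(1)α₀ ≦ 1/6» (`smallness_of_bracket`). [cite: Balaban1985Averaging, (133)–(135) pp.38–39] -/
def C2cov (d : ℕ) : ℝ := 12 * C1cov d

/-- `C1cov d > 0`. [folklore] -/
theorem C1cov_pos (d : ℕ) : 0 < C1cov d := by unfold C1cov; positivity

/-- `O1cov d > 0`. [folklore] -/
theorem O1cov_pos (d : ℕ) : 0 < O1cov d := by unfold O1cov; positivity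

/-- «α₀ ≦ c₃» in plaquette currency: `4α₀ ≤ c₂′(d,L) = 1/(512(d+1)(d+4)L²)` puts the doubled level regularity `2α₀` of
Prop. 2 (54) below row S55's threshold `βmax = 1/(1024(d+1)(d+4)L²)` (loop regularity `≤ 1/64`).
[cite: Balaban1985Averaging, p.37 (after (127))] -/
theorem two_mul_le_betaMax {L : ℕ} {α₀ : ℝ} (hα4 : 4 * α₀ ≤ c2' d L) :
    2 * α₀ ≤ 1 / (1024 * ((d : ℝ) + 1) * ((d : ℝ) + 4) * (L : ℝ) ^ 2) := by
  have h : 1 / (1024 * ((d : ℝ) + 1) * ((d : ℝ) + 4) * (L : ℝ) ^ 2) = c2' d L / 2 := by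
    rw [c2', div_div]; congr 1; ring
  rw [h]; linarith

/-- «for α₁ ≦ ½c₃ we can apply Proposition 3 … at Q_j(U₀, ηA)» (p. 38): `2Lᵏb ≤ c₃` gives `2Lʲb ≤ c₃/2` at every EARLIER
level `j < k` (`L ≥ 2`). [cite: Balaban1985Averaging, p.38 (after (131))] -/
theorem levels_le_half_c3 {L : ℕ} (hL : 2 ≤ L) {k : ℕ} {b : ℝ} (hb : 0 ≤ b)
    (hc₃ : 2 * ((L : ℝ) ^ k * b) ≤ c3 d L) : ∀ j < k, 2 * ((L : ℝ) ^ j * b) ≤ c3 d L / 2 := by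
  intro j hj
  have hL2 : (2 : ℝ) ≤ L := by exact_mod_cast hL
  have h1 : (L : ℝ) * ((L : ℝ) ^ j * b) ≤ (L : ℝ) ^ k * b := by
    rw [← mul_assoc, ← pow_succ']
    exact mul_le_mul_of_nonneg_right (pow_le_pow_right₀ (by linarith) (Nat.succ_le_of_lt hj)) hb
  have h0 : 0 ≤ (L : ℝ) ^ j * b := by positivity
  nlinarith [mul_nonneg h0 (sub_nonneg.2 hL2)]

/-- PRINT'S BRACKET «< e^{O(1)2α₀}(1 + 8C₁α₁)α₁ < 2α₁ for α₀, α₁ sufficiently small [e.g., O(1)α₀ ≦ 1/6, 8C₁α₁ ≦ 1/3]»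
((129)/(131)), here with `O(1)·2α₀ = 4·O1cov(d)·α₀ ≤ 1/3`: `e^{4·O1cov·α₀} ≤ 1/(1 − 1/3) = 3/2` and `(3/2)(1 + 1/3) = 2`.
[cite: Balaban1985Averaging, (129) p.37, (131) p.38] -/
theorem smallness_of_bracket {α₀ t : ℝ} (hα : 0 < α₀) (hα6 : 4 * O1cov d * α₀ ≤ 1 / 3) (ht : 0 ≤ t)
    (h8 : 8 * C1cov d * t ≤ 1 / 3) :
    Real.exp (4 * O1cov d * α₀) ≤ 3 / 2 ∧ Real.exp (4 * O1cov d * α₀) * (1 + 8 * C1cov d * t) ≤ 2 := by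
  have hx0 : 0 < 4 * O1cov d * α₀ := by have := O1cov_pos d; positivity
  have hexp : Real.exp (4 * O1cov d * α₀) ≤ 3 / 2 := by
    have h := Real.exp_bound_div_one_sub_of_interval' hx0 (by linarith)
    refine h.le.trans ?_
    rw [div_le_iff₀ (by linarith)]
    linarith
  refine ⟨hexp, ?_⟩
  have h1 : 0 ≤ 1 + 8 * C1cov d * t := by have := C1cov_pos d; positivity
  calc Real.exp (4 * O1cov d * α₀) * (1 + 8 * C1cov d * t) ≤ (3 / 2) * (1 + 8 * C1cov d * t) :=
        mul_le_mul_of_nonneg_right hexp h1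
    _ ≤ 2 := by linarith

variable {𝔸 : Type*} [NormedRing 𝔸] [NormedAlgebra ℂ 𝔸] [CompleteSpace 𝔸] [NormOneClass 𝔸]

/-! ## §2 (H-lin) discharged: (126) with leading coefficient `L` at every background with small plaquette deviation -/

/-- **(H-lin) DISCHARGED** — `B7Prop4GeneralLevels.prop4_general_of_prop3`'s binder `h3lin` with
`βmax := 1/(1024(d+1)(d+4)L²)`, `c := O1cov d`: for every background `V₀` in a subgroup `G ≤ {|u| ≤ 1, |u⁻¹| ≤ 1}` with
plaquette deviation `pdev V₀ < β ≤ βmax` and every field with `sup_b‖A_b‖ ≤ a`, at every `L`-bond `c`,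
`‖L(Q(V₀)A)_c‖ ≤ L·(1 + O1cov(d)·L²β)·a` — [Balaban1985Averaging] (126) «|(Q(V₀)A)_c| ≦ |A| + O(1)L²α₀|A|» by row S55's
`B7Prop3GeneralLinearBound.norm_linQcov_le` (leading coefficient EXACTLY `L`) at the loop regularity `16(d+1)(d+4)L²β ≤
1/64 ≤ 1/8` that `loopReg_of_pdev` supplies. [cite: Balaban1985Averaging, Proposition 3 (126) p.36] -/
theorem h3lin_discharge {L : ℕ} (hL : 1 ≤ L) {G : Subgroup 𝔸ˣ} (hG : G ≤ U1 𝔸) :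
    ∀ (V₀ : B7Prop1Explicit.Site d → Fin d → 𝔸ˣ) (β : ℝ), (∀ x κ, V₀ x κ ∈ G) → 0 ≤ β → pdev V₀ < β →
      β ≤ 1 / (1024 * ((d : ℝ) + 1) * ((d : ℝ) + 4) * (L : ℝ) ^ 2) →
      ∀ (A : B7Prop1Explicit.Site d → Fin d → 𝔸) (a : ℝ), 0 ≤ a → (∀ x κ, ‖A x κ‖ ≤ a) →
      ∀ q κ, ‖linQcov L V₀ A q κ‖ ≤ L * (1 + O1cov d * (L : ℝ) ^ 2 * β) * a := by
  intro V₀ β hVG hβ0 hβ hβmax A a ha0 hA q κ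
  have hV₀ : ∀ x κ, V₀ x κ ∈ U1 𝔸 := fun x κ => hG (hVG x κ)
  obtain ⟨hreg, hα1⟩ := loopReg_of_pdev hL hV₀ hβ0 hβ hβmax q κ
  have hε0 : 0 ≤ 16 * ((d : ℝ) + 1) * ((d : ℝ) + 4) * (L : ℝ) ^ 2 * β := by positivity
  have hε : 16 * ((d : ℝ) + 1) * ((d : ℝ) + 4) * (L : ℝ) ^ 2 * β ≤ 1 / 8 := by linarith
  have h := norm_linQcov_le L hV₀ ha0 hA hL q κ hε0 hε hreg
  refine h.trans (le_of_eq ?_)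
  simp only [O1cov]
  ring

/-! ## §3 Proposition 4 (130)/(131) at a general regular background — all three binders discharged -/

/-- **[B7] PROPOSITION 4, THE BOUNDS (130)/(131) AT EVERY LEVEL `j ≤ k`, AT A GENERAL REGULAR BACKGROUND, k-UNIFORM —
KERNEL.**  Data (p. 37 «We assume that U₀ satisfies the assumptions of Proposition 2 and U₁ = e^{iηA}, |A| < α₁»): `L ≥ 2`;
`U₀` with values in an averaging-closed subgroup `G` (`B7Prop2Explicit.AvgClosed`), plaquette deviation `pdev U₀ < α₀L^{−2k}`
((52), `η = L^{−k}`), `C₀α₀ ≤ 1/3` (Prop. 2) and `4α₀ ≤ c₂′(d,L)` («2α₀L^{2j}η² < α₀ ≦ c₃», p. 37); the field `B` («iηA»)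
with `sup‖B‖ ≤ b` («|A| < α₁», `b = ηα₁`); smallness `e^{4·O1cov(d)·α₀}(1 + 8·C1cov(d)·Lᵏb) ≤ 2` («e^{O(1)2α₀}(1 + 8C₁α₁)α₁ <
2α₁», (131)) and `2Lᵏb ≤ c₃(d,L)` («α₁ ≦ ½c₃»).  CONCLUSION, for every `j ≤ k` and every `Lʲ`-bond: (130)
`‖Q_j(U₀, ηB) − LʲηQ_j(U₀)B‖ ≤ 8·C1cov(d)·e^{4·O1cov(d)·α₀}·(Lʲb)²` and (131) = (161) `‖Q_j(U₀, ηB)‖ ≤ 2Lʲb`, for the composites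
`logCovIter`/`linCovIter` (127) of the paper's one-step maps (121)/(122).  Proof: file 2's `prop4_general_of_prop3` with
`h3rem_discharge`, `h3lin_discharge`, `h3sub_discharge`. [cite: Balaban1985Averaging, (130)–(131) p.38, (127) p.37, (161) p.42] -/
theorem prop4_general_bounds (L : ℕ) (hL : 2 ≤ L) {G : Subgroup 𝔸ˣ} (hG : AvgClosed d L G) (k : ℕ)
    (U₀ : B7Prop1Explicit.Site d → Fin d → 𝔸ˣ) (hU₀ : ∀ x κ, U₀ x κ ∈ G) {α₀ : ℝ} (hα : 0 < α₀)
    (hα3 : C0 d * α₀ ≤ 1 / 3) (hα4 : 4 * α₀ ≤ c2' d L) (h52 : pdev U₀ < α₀ * (((L : ℝ) ^ k)⁻¹) ^ 2)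
    (B : B7Prop1Explicit.Site d → Fin d → 𝔸) {b : ℝ} (hb : 0 ≤ b) (hB : ∀ x κ, ‖B x κ‖ ≤ b)
    (hsmall : Real.exp (4 * O1cov d * α₀) * (1 + 8 * C1cov d * ((L : ℝ) ^ k * b)) ≤ 2)
    (hc₃ : 2 * ((L : ℝ) ^ k * b) ≤ c3 d L) :
    ∀ j ≤ k,
      (∀ z κ, ‖logCovIter L U₀ B j z κ - linCovIter L U₀ B j z κ‖
        ≤ 8 * C1cov d * Real.exp (4 * O1cov d * α₀) * ((L : ℝ) ^ j * b) ^ 2) ∧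
      (∀ z κ, ‖logCovIter L U₀ B j z κ‖ ≤ 2 * ((L : ℝ) ^ j * b)) := by
  have hL1 : 1 ≤ L := le_trans (by norm_num) hL
  have hα2 : 2 * α₀ ≤ c2' d L := by linarith
  exact prop4_general_of_prop3 L hL hG (C₁ := C1cov d) (c := O1cov d) (c₃ := c3 d L / 2)
    (βmax := 1 / (1024 * ((d : ℝ) + 1) * ((d : ℝ) + 4) * (L : ℝ) ^ 2)) (C1cov_pos d).le (O1cov_pos d).le
    (h3rem_discharge hL1 hG.le_U1) (h3lin_discharge hL1 hG.le_U1) (h3sub_discharge hL1 hG.le_U1)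
    k U₀ hU₀ hα hα3 hα2 h52 (two_mul_le_betaMax hα4) B hb hB hsmall (levels_le_half_c3 hL hb hc₃)

/-- **(134)–(135) at `j = k` with `C₂ = 8·C1cov(d)·e^{4·O1cov(d)·α₀}` INDEPENDENT OF `k`** («|C_k(U₀, A)| ≦ C₂|A|²», «C₂ =
e^{O(1)2α₀}8C₁»): the remainder `C_k(U₀, B) := Q_k(U₀, ηB) − LᵏηQ_k(U₀)B` of the paper's composite, under the hypotheses of
`prop4_general_bounds`. [cite: Balaban1985Averaging, (133)–(135) pp.38–39] -/
theorem prop4_general_remainder (L : ℕ) (hL : 2 ≤ L) {G : Subgroup 𝔸ˣ} (hG : AvgClosed d L G) (k : ℕ)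
    (U₀ : B7Prop1Explicit.Site d → Fin d → 𝔸ˣ) (hU₀ : ∀ x κ, U₀ x κ ∈ G) {α₀ : ℝ} (hα : 0 < α₀)
    (hα3 : C0 d * α₀ ≤ 1 / 3) (hα4 : 4 * α₀ ≤ c2' d L) (h52 : pdev U₀ < α₀ * (((L : ℝ) ^ k)⁻¹) ^ 2)
    (B : B7Prop1Explicit.Site d → Fin d → 𝔸) {b : ℝ} (hb : 0 ≤ b) (hB : ∀ x κ, ‖B x κ‖ ≤ b)
    (hsmall : Real.exp (4 * O1cov d * α₀) * (1 + 8 * C1cov d * ((L : ℝ) ^ k * b)) ≤ 2)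
    (hc₃ : 2 * ((L : ℝ) ^ k * b) ≤ c3 d L) (z : B7Prop1Explicit.Site d) (κ : Fin d) :
    ‖logCovIter L U₀ B k z κ - linCovIter L U₀ B k z κ‖
      ≤ (8 * C1cov d * Real.exp (4 * O1cov d * α₀)) * ((L : ℝ) ^ k * b) ^ 2 :=
  (prop4_general_bounds L hL hG k U₀ hU₀ hα hα3 hα4 h52 B hb hB hsmall hc₃ k le_rfl).1 z κ

/-! ## §4 «(1/i) log U̿₁ᵏ as a function of (1/i) log U₁ is a composition of the functions (127)»: `U̿₁ʲ = e^{Q_j}` -/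

/-- per-level data: every `Ū₀ʲ`, `j ≤ k`, is `G`-valued with plaquette deviation `< 2α₀(Lʲ/Lᵏ)² ≤ βmax`
(`B7Prop4GeneralLevels.level_regularity` = Prop. 2 per level, + `two_mul_le_betaMax`). [folklore] -/
private theorem level_data (L : ℕ) (hL : 2 ≤ L) {G : Subgroup 𝔸ˣ} (hG : AvgClosed d L G) (k : ℕ)
    (U₀ : B7Prop1Explicit.Site d → Fin d → 𝔸ˣ) (hU₀ : ∀ x κ, U₀ x κ ∈ G) {α₀ : ℝ} (hα : 0 < α₀)
    (hα3 : C0 d * α₀ ≤ 1 / 3) (hα4 : 4 * α₀ ≤ c2' d L) (h52 : pdev U₀ < α₀ * (((L : ℝ) ^ k)⁻¹) ^ 2) :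
    ∀ j ≤ k, (∀ x κ, avgIter L U₀ j x κ ∈ U1 𝔸) ∧ 0 ≤ 2 * (α₀ * ((L : ℝ) ^ j * ((L : ℝ) ^ k)⁻¹) ^ 2) ∧
      pdev (avgIter L U₀ j) < 2 * (α₀ * ((L : ℝ) ^ j * ((L : ℝ) ^ k)⁻¹) ^ 2) ∧
      2 * (α₀ * ((L : ℝ) ^ j * ((L : ℝ) ^ k)⁻¹) ^ 2) ≤ 1 / (1024 * ((d : ℝ) + 1) * ((d : ℝ) + 4) * (L : ℝ) ^ 2) := by
  intro j hj
  have hα2 : 2 * α₀ ≤ c2' d L := by linarith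
  have hreg := level_regularity L hL hG k U₀ hU₀ hα hα3 hα2 h52 j hj
  have hL1 : (1 : ℝ) ≤ L := by exact_mod_cast le_trans (by norm_num) hL
  have hLk : (0 : ℝ) < (L : ℝ) ^ k := by positivity
  have hratio : (L : ℝ) ^ j * ((L : ℝ) ^ k)⁻¹ ≤ 1 := by
    rw [mul_inv_le_iff₀ hLk, one_mul]; exact pow_le_pow_right₀ hL1 hj
  have h1 : ((L : ℝ) ^ j * ((L : ℝ) ^ k)⁻¹) ^ 2 ≤ 1 := by
    rw [← one_pow 2]; exact pow_le_pow_left₀ (by positivity) hratio 2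
  refine ⟨fun x κ => hG.le_U1 (hreg.2 x κ), by positivity, hreg.1, ?_⟩
  have := two_mul_le_betaMax (d := d) hα4
  nlinarith [mul_le_mul_of_nonneg_left h1 hα.le]

/-- **`U̿₁ʲ = e^{Q_j(U₀, ηB)}` BONDWISE FOR EVERY `j ≤ k`** — p. 37 (127): «(1/i) log U̿₁ᵏ as a function of (1/i) log U₁ is a
composition of the functions Q(U₀, ·), Q(Ū₀, ·), …, Q(Ū₀^{k−1}, ·)»: under the hypotheses of `prop4_general_bounds` the
iterate (90)/(91) `dbavgCovIter L U₀ (e^{B}) j` (`B7Eq92Concrete`) of `U₁ = e^{B}` at the background `U₀` equals `e^{logCovIter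
L U₀ B j}`.  Induction on `j`: at each level the argument of the one-step average has sup norm `≤ 2Lʲb ≤ c₃/2` ((131)) and the
level background is regular (`level_data`), so `‖V̿₁ − 1‖ ≤ 4/5 < 1` (`B7Prop3GeneralAnalytic.logDomainCov`) and `e^{log V̿₁} =
V̿₁` (`B7Prop4Flat.expUnit_mlog`, the series (21)/(22)). [cite: Balaban1985Averaging, (127) p.37, (90)–(91) p.31, (21)–(22) p.21] -/
theorem dbavgCovIter_eq_expCfg_logCovIter (L : ℕ) (hL : 2 ≤ L) {G : Subgroup 𝔸ˣ} (hG : AvgClosed d L G) (k : ℕ)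
    (U₀ : B7Prop1Explicit.Site d → Fin d → 𝔸ˣ) (hU₀ : ∀ x κ, U₀ x κ ∈ G) {α₀ : ℝ} (hα : 0 < α₀)
    (hα3 : C0 d * α₀ ≤ 1 / 3) (hα4 : 4 * α₀ ≤ c2' d L) (h52 : pdev U₀ < α₀ * (((L : ℝ) ^ k)⁻¹) ^ 2)
    (B : B7Prop1Explicit.Site d → Fin d → 𝔸) {b : ℝ} (hb : 0 ≤ b) (hB : ∀ x κ, ‖B x κ‖ ≤ b)
    (hsmall : Real.exp (4 * O1cov d * α₀) * (1 + 8 * C1cov d * ((L : ℝ) ^ k * b)) ≤ 2)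
    (hc₃ : 2 * ((L : ℝ) ^ k * b) ≤ c3 d L) :
    ∀ j ≤ k, dbavgCovIter L U₀ (expCfg B) j = expCfg (logCovIter L U₀ B j) := by
  have hL1 : 1 ≤ L := le_trans (by norm_num) hL
  have hbd := prop4_general_bounds L hL hG k U₀ hU₀ hα hα3 hα4 h52 B hb hB hsmall hc₃
  have hlev := level_data L hL hG k U₀ hU₀ hα hα3 hα4 h52
  have hc₃' := levels_le_half_c3 (d := d) hL hb hc₃
  intro j
  induction j with
  | zero => intro _; rfl
  | succ j ih =>
    intro hjk
    have hj : j < k := Nat.lt_of_succ_le hjk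
    obtain ⟨hV₀, hβ0, hβ, hβmax⟩ := hlev j hj.le
    have hA : ∀ x κ', ‖logCovIter L U₀ B j x κ'‖ ≤ 2 * ((L : ℝ) ^ j * b) := (hbd j hj.le).2
    have hac : 2 * ((L : ℝ) ^ j * b) ≤ c3 d L := (hc₃' j hj).trans (by linarith [c3_pos d hL1])
    funext z κ
    obtain ⟨hreg, hα1⟩ := loopReg_of_pdev hL1 hV₀ hβ0 hβ hβmax ((L : ℤ) • z) κ
    have hdom := (logDomainCov hL1 hV₀ (logCovIter L U₀ B j) (by positivity) hA le_rfl (by positivity)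
      (theta_le_of_le_c3 hL1 hac) ((L : ℤ) • z) κ hα1 hreg).2.2.2
    have hlt : ‖((dbavgCov L (avgIter L U₀ j) (expCfg (logCovIter L U₀ B j)) ((L : ℤ) • z) κ : 𝔸ˣ) : 𝔸) - 1‖ < 1 :=
      hdom.trans_lt (by norm_num)
    rw [dbavgCovIter_succ, ih hj.le]
    show _ = expUnit (mlog ((dbavgCov L (avgIter L U₀ j) (expCfg (logCovIter L U₀ B j)) ((L : ℤ) • z) κ : 𝔸ˣ) : 𝔸))
    rw [B7Prop4Flat.expUnit_mlog hlt]

/-- hence `(1/i) log U̿₁^{j+1} = Q_{j+1}(U₀, ηB)` bondwise (`j + 1 ≤ k`): the logarithm (21) of the iterate (91) is the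
composed function (127). [cite: Balaban1985Averaging, (127) p.37, (121) p.36] -/
theorem mlog_dbavgCovIter (L : ℕ) (hL : 2 ≤ L) {G : Subgroup 𝔸ˣ} (hG : AvgClosed d L G) (k : ℕ)
    (U₀ : B7Prop1Explicit.Site d → Fin d → 𝔸ˣ) (hU₀ : ∀ x κ, U₀ x κ ∈ G) {α₀ : ℝ} (hα : 0 < α₀)
    (hα3 : C0 d * α₀ ≤ 1 / 3) (hα4 : 4 * α₀ ≤ c2' d L) (h52 : pdev U₀ < α₀ * (((L : ℝ) ^ k)⁻¹) ^ 2)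
    (B : B7Prop1Explicit.Site d → Fin d → 𝔸) {b : ℝ} (hb : 0 ≤ b) (hB : ∀ x κ, ‖B x κ‖ ≤ b)
    (hsmall : Real.exp (4 * O1cov d * α₀) * (1 + 8 * C1cov d * ((L : ℝ) ^ k * b)) ≤ 2)
    (hc₃ : 2 * ((L : ℝ) ^ k * b) ≤ c3 d L) {j : ℕ} (hjk : j + 1 ≤ k) (z : B7Prop1Explicit.Site d) (κ : Fin d) :
    mlog ((dbavgCovIter L U₀ (expCfg B) (j + 1) z κ : 𝔸ˣ) : 𝔸) = logCovIter L U₀ B (j + 1) z κ := by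
  rw [dbavgCovIter_succ, dbavgCovIter_eq_expCfg_logCovIter L hL hG k U₀ hU₀ hα hα3 hα4 h52 B hb hB hsmall hc₃ j
    (Nat.le_of_succ_le hjk), logCovIter_succ]
  rfl

/-! ## §5 The analyticity clause: «Q_k(U₀, ηA, c) … is an analytic function of the variables A_b» -/

variable {E : Type*} [NormedAddCommGroup E] [NormedSpace ℂ E]

/-- **[B7] PROPOSITION 4, THE ANALYTICITY CLAUSE AT A GENERAL REGULAR BACKGROUND — KERNEL** (parametrised form, as b07's
`B7Prop4Flat.prop4_flat_analyticAt`): let the initial field depend on a parameter `t` in a complex normed space `E` with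
every bond variable `t ↦ B(t)_b` analytic at `t₀`, and let the hypotheses of `prop4_general_bounds` hold at `t₀`.  Then for
every `j ≤ k` and every `Lʲ`-bond the composite `t ↦ Q_j(U₀, ηB(t))` (= `logCovIter L U₀ (B t) j`) is analytic at `t₀` —
(127) with every factor `Q(Ū₀ʲ, ·)` analytic by Prop. 3 at the level background (`B7Prop3GeneralAnalytic.
prop3_general_analyticAt_of_le_c3`) on the domain supplied by (131): `sup‖Q_j‖ ≤ 2Lʲb ≤ c₃/2` (file 1's
`prop4_induction_analyticAt`). [cite: Balaban1985Averaging, Proposition 4 p.38, (127) p.37, (131) p.38] -/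
theorem prop4_general_analyticAt (L : ℕ) (hL : 2 ≤ L) {G : Subgroup 𝔸ˣ} (hG : AvgClosed d L G) (k : ℕ)
    (U₀ : B7Prop1Explicit.Site d → Fin d → 𝔸ˣ) (hU₀ : ∀ x κ, U₀ x κ ∈ G) {α₀ : ℝ} (hα : 0 < α₀)
    (hα3 : C0 d * α₀ ≤ 1 / 3) (hα4 : 4 * α₀ ≤ c2' d L) (h52 : pdev U₀ < α₀ * (((L : ℝ) ^ k)⁻¹) ^ 2)
    (Bt : E → B7Prop1Explicit.Site d → Fin d → 𝔸) (t₀ : E) (hBan : ∀ x κ, AnalyticAt ℂ (fun t => Bt t x κ) t₀)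
    {b : ℝ} (hb : 0 ≤ b) (hB : ∀ x κ, ‖Bt t₀ x κ‖ ≤ b)
    (hsmall : Real.exp (4 * O1cov d * α₀) * (1 + 8 * C1cov d * ((L : ℝ) ^ k * b)) ≤ 2)
    (hc₃ : 2 * ((L : ℝ) ^ k * b) ≤ c3 d L) :
    ∀ j ≤ k, ∀ z κ, AnalyticAt ℂ (fun t => logCovIter L U₀ (Bt t) j z κ) t₀ := by
  have hL1 : 1 ≤ L := le_trans (by norm_num) hL
  have hLr : (2 : ℝ) ≤ L := by exact_mod_cast hL
  have hlev := level_data L hL hG k U₀ hU₀ hα hα3 hα4 h52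
  have hc3half : c3 d L / 2 ≤ c3 d L := by linarith [c3_pos d hL1]
  set κ : ℕ → ℝ := fun j => O1cov d * (L : ℝ) ^ 2 * (2 * (α₀ * ((L : ℝ) ^ j * ((L : ℝ) ^ k)⁻¹) ^ 2)) with hκdef
  have hκ0 : ∀ j, 0 ≤ κ j := fun j => by have := O1cov_pos d; positivity
  exact prop4_induction_analyticAt (σ := B7Prop1Explicit.Site d) (τ := Fin d) (𝔸 := 𝔸) (E := E)
    (c₃ := c3 d L / 2) (P := Real.exp (4 * O1cov d * α₀)) hLr (C1cov_pos d).le (k := k) κ hκ0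
    (fun j A z κ' => Qcov L (avgIter L U₀ j) A ((L : ℤ) • z) κ')
    (fun j A z κ' => linQcov L (avgIter L U₀ j) A ((L : ℤ) • z) κ')
    (fun j hj A A' => funext fun z => funext fun κ' =>
      h3sub_discharge hL1 (le_refl (U1 𝔸)) _ _ (hlev j hj.le).1 (hlev j hj.le).2.1 (hlev j hj.le).2.2.1
        (hlev j hj.le).2.2.2 A A' _ κ')
    (fun j hj A r hr hrc hA z κ' =>
      h3rem_discharge hL1 (le_refl (U1 𝔸)) _ _ (hlev j hj.le).1 (hlev j hj.le).2.1 (hlev j hj.le).2.2.1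
        (hlev j hj.le).2.2.2 A r hr hrc hA _ κ')
    (fun j hj A r hr hA z κ' => by
      have h := h3lin_discharge hL1 (le_refl (U1 𝔸)) _ _ (hlev j hj.le).1 (hlev j hj.le).2.1 (hlev j hj.le).2.2.1
        (hlev j hj.le).2.2.2 A r hr hA ((L : ℤ) • z) κ'
      have hκj : (L : ℝ) * (1 + O1cov d * (L : ℝ) ^ 2 * (2 * (α₀ * ((L : ℝ) ^ j * ((L : ℝ) ^ k)⁻¹) ^ 2))) * r
          = L * (1 + κ j) * r := by rw [hκdef]
      rw [← hκj]; exact h)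
    (fun j hj A t₁ r hr hrc hA hAan z κ' => by
      obtain ⟨hV₀, hβ0, hβ, hβmax⟩ := hlev j hj.le
      obtain ⟨hreg, hα1⟩ := loopReg_of_pdev hL1 hV₀ hβ0 hβ hβmax ((L : ℤ) • z) κ'
      exact prop3_general_analyticAt_of_le_c3 A hAan hL1 hV₀ hr hA (hrc.trans hc3half) ((L : ℤ) • z) κ' hα1 hreg)
    Bt t₀ hBan hb hB (fun j t => logCovIter L U₀ (Bt t) j) (fun t => rfl)
    (fun j _ t => funext fun z => funext fun κ' => logCovIter_succ L U₀ (Bt t) j z κ')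
    (levelFactors_prod_le_exp hLr (O1cov_pos d).le hα.le k) hsmall (levels_le_half_c3 hL hb hc₃)

/-! ## §6 Proposition 4 in the printed shape, under print's bracket smallness -/

/-- **[B7] PROPOSITION 4 AT A GENERAL REGULAR BACKGROUND, PRINTED SHAPE (134)–(135) WITH (131) = (161), `C₂` DEPENDING ON
`d` ONLY — KERNEL.**  «There exist constants C₂, c₄ such that for α₀, α₁ ≦ c₄ the function Q_k(U₀, ηA, c) = (1/i) log(U̿₁ᵏ)_c
… Q_k(U₀, ηA) = Q_k(U₀)A + C_k(U₀, A), (134) and |C_k(U₀, A)| ≦ C₂|A|² < C₂α₁². (135)», «The constants C₂, c₄ are independent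
of k, C₂ depends on d and c₄ depends on d and L.»  Here: `L ≥ 2`, `k ≥ 1`; `U₀` `G`-valued (`AvgClosed d L G`) with `pdev U₀ <
α₀L^{−2k}`, `C₀α₀ ≤ 1/3`, `4α₀ ≤ c₂′(d,L)`, `4·O1cov(d)·α₀ ≤ 1/3` (print's «O(1)α₀ ≦ 1/6»); `U₁ = e^{B}` with `sup‖B‖ ≤ b`,
`8·C1cov(d)·Lᵏb ≤ 1/3` («8C₁α₁ ≦ 1/3») and `2Lᵏb ≤ c₃(d,L)` («α₁ ≦ ½c₃») — print's `c₄(d,L)` is the minimum of these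
thresholds.  THEN at every `Lᵏ`-bond `c`: `‖(1/i) log U̿₁ᵏ(c) − LᵏηQ_k(U₀)B(c)‖ ≤ C2cov(d)·(Lᵏb)²` with `C2cov d = 12·C1cov d`
(INDEPENDENT of `k` and `α₀`), `‖(1/i) log U̿₁ᵏ(c)‖ ≤ 2Lᵏb` ((131)/(161)), and `U̿₁ᵏ(c) = exp((1/i) log U̿₁ᵏ(c))`, for the
iterate (90)/(91) `dbavgCovIter` and the composed linear part `linCovIter`.
[cite: Balaban1985Averaging, Proposition 4 (134)–(135) pp.38–39, (131) p.38, (161) p.42] -/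
theorem prop4_general (L : ℕ) (hL : 2 ≤ L) {G : Subgroup 𝔸ˣ} (hG : AvgClosed d L G) (k : ℕ) (hk : 1 ≤ k)
    (U₀ : B7Prop1Explicit.Site d → Fin d → 𝔸ˣ) (hU₀ : ∀ x κ, U₀ x κ ∈ G) {α₀ : ℝ} (hα : 0 < α₀)
    (hα3 : C0 d * α₀ ≤ 1 / 3) (hα4 : 4 * α₀ ≤ c2' d L) (hα6 : 4 * O1cov d * α₀ ≤ 1 / 3)
    (h52 : pdev U₀ < α₀ * (((L : ℝ) ^ k)⁻¹) ^ 2)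
    (B : B7Prop1Explicit.Site d → Fin d → 𝔸) {b : ℝ} (hb : 0 ≤ b) (hB : ∀ x κ, ‖B x κ‖ ≤ b)
    (h8 : 8 * C1cov d * ((L : ℝ) ^ k * b) ≤ 1 / 3) (hc₃ : 2 * ((L : ℝ) ^ k * b) ≤ c3 d L)
    (z : B7Prop1Explicit.Site d) (κ : Fin d) :
    ‖mlog ((dbavgCovIter L U₀ (expCfg B) k z κ : 𝔸ˣ) : 𝔸) - linCovIter L U₀ B k z κ‖ ≤ C2cov d * ((L : ℝ) ^ k * b) ^ 2 ∧
      ‖mlog ((dbavgCovIter L U₀ (expCfg B) k z κ : 𝔸ˣ) : 𝔸)‖ ≤ 2 * ((L : ℝ) ^ k * b) ∧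
      ((dbavgCovIter L U₀ (expCfg B) k z κ : 𝔸ˣ) : 𝔸) = exp (mlog ((dbavgCovIter L U₀ (expCfg B) k z κ : 𝔸ˣ) : 𝔸)) := by
  obtain ⟨hexp, hsmall⟩ := smallness_of_bracket (d := d) hα hα6 (by positivity : 0 ≤ (L : ℝ) ^ k * b) h8
  obtain ⟨j, rfl⟩ : ∃ j, k = j + 1 := ⟨k - 1, by omega⟩
  obtain ⟨hE, hA⟩ := prop4_general_bounds L hL hG (j + 1) U₀ hU₀ hα hα3 hα4 h52 B hb hB hsmall hc₃ (j + 1) le_rfl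
  have hval : mlog ((dbavgCovIter L U₀ (expCfg B) (j + 1) z κ : 𝔸ˣ) : 𝔸) = logCovIter L U₀ B (j + 1) z κ :=
    mlog_dbavgCovIter L hL hG (j + 1) U₀ hU₀ hα hα3 hα4 h52 B hb hB hsmall hc₃ le_rfl z κ
  have hX := dbavgCovIter_eq_expCfg_logCovIter L hL hG (j + 1) U₀ hU₀ hα hα3 hα4 h52 B hb hB hsmall hc₃ (j + 1) le_rfl
  refine ⟨?_, ?_, ?_⟩
  · rw [hval]
    refine (hE z κ).trans ?_
    have h0 : 0 ≤ ((L : ℝ) ^ (j + 1) * b) ^ 2 := sq_nonneg _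
    have hC : 8 * C1cov d * Real.exp (4 * O1cov d * α₀) ≤ C2cov d := by
      have := C1cov_pos d
      unfold C2cov; nlinarith
    exact mul_le_mul_of_nonneg_right hC h0
  · rw [hval]; exact hA z κ
  · rw [hval, hX]; rfl

end Summit.QuantumFields.BalabanUV.T4Continuum.ShellMeasureAverageProp4General

end
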